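import Mathlib
import Literature.NumberTheory.LFunctions.Zhang2022.TypedSection13
import Literature.NumberTheory.LFunctions.Zhang2022.SkeletonAssembly
import Literature.NumberTheory.LFunctions.Zhang2022.Section6ZfacSize
import Literature.NumberTheory.LFunctions.Zhang2022.Section3Lemma33
import HarnessLib

/-!
# Zhang (2022) §13 p. 75 — tools for the (13.11)-estimate "via Lemma 6.1 and 3.3" (`U007b`):
# `|Z(s,ψ)|⁻¹ ≤ e¹⁶` near the critical line, the large sieve for weighted short Dirichlet polynomials,
# the harmonic-type bound `Σ_{n≤P²} n^{−1±O(α)} ≪ 𝓛⁹`, and Cauchy–Schwarz for interval integrals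

Topic `Literature/NumberTheory/LFunctions/Zhang2022` (Landau–Siegel audit tree; verdict-neutral).
Y. Zhang, *Discrete mean estimates and the Landau–Siegel zero*, arXiv:2211.02515v1 (2022)
[Zhang2022LandauSiegel], §13 p. 75 (tex L3817: "the right side being estimated via Lemma 5.9, 6.1
and 3.3"), with the printed parallel of §8 p. 44 (tex L2244–2250: `Σ_{ψ∈Ψ₁}|L(s+β₂,ψ)L(s+β₃,ψ)|²
≪ P²𝓛³⁶` "by Lemma 6.1 and the large sieve"). Campaign D-0069, GAP-LEDGER row G-L3t6-3, reconstructed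
target `Typed.Section13.U007b` (L3-t6, p413496); this file holds the reusable tools for its proof
(companion file `Section13U007b.lean`). Everything here is elementary bookkeeping around TREE
THEOREMS: `GammaFactor.norm_Zfac_half_eq_one` / `analyticAt_Zfac` / `norm_logDeriv_Zfac_add_log_le`
(Stirling for `Z′/Z`), `Lemma45.eq_mul_exp_integral_logDeriv_segment`, `Section6Statements.log_window`
/ `two_alpha_le`, and the LANDED large sieve `Skeleton.lemma33b_sum_le` (Lemma 3.3, second
assertion, kernel-proved). 0 new facts; no claim of the manuscript is used.

* `exp_neg_le_norm_Zfac_of_abs_sub_half_le` — the lower companion of the tree's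
  `norm_Zfac_le_exp_of_abs_sub_half_le`: `|Z(σ+it,θ)| ≥ exp(−|σ−½|(|log(kt/2π)| + 14/t))`;
* `norm_inv_Zfac_le_exp_sixteen` — `|Z(s,ψ)|⁻¹ ≤ e¹⁶` for `ψ ∈ Ψ`, `|σ−½| ≤ 2α`, `|t−2πt₀| < 𝓛₁+2`;
* `meanSq_Ico_le` — `Σ_{ψ∈T}|Σ_{n<N} ψ(n)n^{−s}w(n)|² ≤ C₃₃P²Σ_{n≤P²}n^{−2σ}` (`|w| ≤ 1`, `N ≤ P²+1`);
* `sum_rpow_Icc_le` — `Σ_{n≤P²} n^{e} ≤ e^{8π}(1 + 2𝓛⁹)` for `|e + 1| ≤ 4α`;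
* `sq_integral_le` — `(∫_a^b f)² ≤ (b−a)∫_a^b f²` for continuous real `f`.

WHAT THIS IS NOT: any claim about Theorems 1–2 of the manuscript or about Landau–Siegel zeros.

## References

* Y. Zhang, arXiv:2211.02515v1 (2022), §13 p. 75; §8 p. 44; §3 Lemma 3.3; §5 Lemma 5.1 (proof).
  [cite: Zhang2022LandauSiegel, §13 p.75]
-/

noncomputable section

open Complex Real Set MeasureTheory intervalIntegral

namespace Literature.NumberTheory.LFunctions.Zhang2022.Typed.Section13

open Skeleton GammaFactor

/-! ## `|Z(s,θ)|` is bounded BELOW near the critical line -/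

/-- **Lower companion of `norm_Zfac_le_exp_of_abs_sub_half_le`**: for a primitive `θ (mod k)`,
`|σ − 1/2| ≤ 1/4`, `t ≥ 4`: `exp(−|σ − 1/2|·(|log(kt/2π)| + 14/t)) ≤ |Z(σ+it,θ)|` (same proof:
`|Z(1/2+it)| = 1` and the Stirling bound for `Z′/Z` integrated horizontally; `Re w ≥ −‖w‖`).
[cite: Zhang2022LandauSiegel, §5 Lemma 5.1 (proof)] -/
theorem exp_neg_le_norm_Zfac_of_abs_sub_half_le {k : ℕ} [NeZero k] {θ : DirichletCharacter ℂ k}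
    (hθ : θ.IsPrimitive) {σ t : ℝ} (hσ : |σ - 1 / 2| ≤ 1 / 4) (ht : 4 ≤ t) :
    Real.exp (-(|σ - 1 / 2| * (|Real.log ((k : ℝ) * t / (2 * π))| + 14 / t)))
      ≤ ‖Zfac θ ((σ : ℂ) + t * I)‖ := by
  have ht0 : 0 < t := by linarith
  set a : ℂ := (1 / 2 : ℂ) + t * I with ha
  set w : ℂ := ((σ - 1 / 2 : ℝ) : ℂ) with hw
  set L : ℝ := Real.log ((k : ℝ) * t / (2 * π)) with hL
  have hpt : ∀ x : ℝ, a + (x : ℂ) * w = ((1 / 2 + x * (σ - 1 / 2) : ℝ) : ℂ) + t * I := by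
    intro x; rw [ha, hw]; push_cast; ring
  have hu : ∀ x ∈ Icc (0 : ℝ) 1,
      0 < 1 / 2 + x * (σ - 1 / 2) ∧ 1 / 2 + x * (σ - 1 / 2) ≤ 1 := by
    intro x hx
    have h1 : |x * (σ - 1 / 2)| ≤ 1 / 4 := by
      rw [abs_mul, abs_of_nonneg hx.1]
      calc x * |σ - 1 / 2| ≤ 1 * (1 / 4) :=
            mul_le_mul hx.2 hσ (abs_nonneg _) zero_le_one
        _ = 1 / 4 := one_mul _
    obtain ⟨h1a, h1b⟩ := abs_le.mp h1
    constructor <;> linarith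
  have him : ∀ x : ℝ, 0 < (a + (x : ℂ) * w).im := by
    intro x; rw [hpt]; simpa using ht0
  have hg : ∀ x ∈ Icc (0 : ℝ) 1, AnalyticAt ℂ (Zfac θ) (a + x * w) :=
    fun x _ => analyticAt_Zfac θ (him x)
  have h0 : ∀ x ∈ Icc (0 : ℝ) 1, Zfac θ (a + x * w) ≠ 0 :=
    fun x _ => Zfac_ne_zero hθ (him x)
  have key := Lemma45.eq_mul_exp_integral_logDeriv_segment hg h0
  have haw : a + w = (σ : ℂ) + t * I := by rw [ha, hw]; push_cast; ring
  have ha1 : ‖Zfac θ a‖ = 1 := norm_Zfac_half_eq_one hθ ht0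
  have hpw : ∀ x ∈ Set.uIoc (0 : ℝ) 1,
      ‖deriv (Zfac θ) (a + x * w) / Zfac θ (a + x * w)‖ ≤ |L| + 14 / t := by
    intro x hx
    have hx' : x ∈ Icc (0 : ℝ) 1 := by
      rw [Set.uIoc_of_le zero_le_one] at hx; exact ⟨hx.1.le, hx.2⟩
    obtain ⟨hu0, hu1⟩ := hu x hx'
    have hlog := norm_logDeriv_Zfac_add_log_le hθ (A := 1) (σ := 1 / 2 + x * (σ - 1 / 2))
      (t := t) (y := 0) le_rfl hu0 hu1 (by linarith) (by rw [abs_zero]; linarith)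
    have hpt' : ((1 / 2 + x * (σ - 1 / 2) : ℝ) : ℂ) + t * I + ((0 : ℝ) : ℂ) * I = a + x * w := by
      rw [hpt]; push_cast; ring
    rw [hpt', logDeriv_apply] at hlog
    have h14 : (2 * |(0 : ℝ)| + 4 * 1 + 10) / t = 14 / t := by rw [abs_zero]; ring
    rw [h14] at hlog
    calc ‖deriv (Zfac θ) (a + x * w) / Zfac θ (a + x * w)‖
        = ‖(deriv (Zfac θ) (a + x * w) / Zfac θ (a + x * w) + (L : ℂ)) - (L : ℂ)‖ := by
          rw [add_sub_cancel_right]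
      _ ≤ ‖deriv (Zfac θ) (a + x * w) / Zfac θ (a + x * w) + (L : ℂ)‖ + ‖(L : ℂ)‖ :=
          norm_sub_le _ _
      _ ≤ 14 / t + |L| := by
          rw [Complex.norm_real, Real.norm_eq_abs]
          exact add_le_add hlog le_rfl
      _ = |L| + 14 / t := add_comm _ _
  have hint := intervalIntegral.norm_integral_le_of_norm_le_const hpw
  rw [sub_zero, abs_one, mul_one] at hint
  rw [← haw, key, norm_mul, ha1, one_mul, Complex.norm_exp]
  refine Real.exp_le_exp.mpr ?_
  have hre : -‖w * ∫ x in (0 : ℝ)..1, deriv (Zfac θ) (a + x * w) / Zfac θ (a + x * w)‖ ≤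
      (w * ∫ x in (0 : ℝ)..1, deriv (Zfac θ) (a + x * w) / Zfac θ (a + x * w)).re := by
    have := Complex.abs_re_le_norm (w * ∫ x in (0 : ℝ)..1,
      deriv (Zfac θ) (a + x * w) / Zfac θ (a + x * w))
    exact (abs_le.mp this).1
  refine le_trans ?_ hre
  rw [neg_le_neg_iff, norm_mul, hw, Complex.norm_real, Real.norm_eq_abs]
  exact mul_le_mul_of_nonneg_left hint (abs_nonneg _)

/-- **`|Z(s,ψ)|⁻¹ ≤ e¹⁶` on Lemma 6.1's range** (`ψ ∈ Ψ`, `|σ − 1/2| ≤ 2α`, `|t − 2πt₀| < 𝓛₁ + 2`,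
`𝓛 ≥ 3`; same numerology as `Section6Statements.norm_Zfac_le_exp_sixteen`: `2α(|log(pt/2π)| + 14/t)
≤ 4π + 1 ≤ 16`). [cite: Zhang2022LandauSiegel, §5 Lemma 5.1 (proof); §13 p.75] -/
theorem norm_inv_Zfac_le_exp_sixteen {D : ℕ} (x : Chr D) (hL : 3 ≤ ell D) {σ t : ℝ}
    (hσ : |σ - 1 / 2| ≤ 2 * alpha D) (ht : |t - 2 * π * ell D ^ 519| < ell D ^ 405 + 2) :
    ‖(Zfac x.ψ ((σ : ℂ) + t * I))⁻¹‖ ≤ Real.exp 16 := by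
  have hL1 : 1 ≤ ell D := by linarith
  have hL0 : 0 < ell D := by linarith
  have hα : alpha D = π / ell D ^ 9 := by rw [alpha, bigP, Real.log_exp]
  have h9 : (3 : ℝ) ^ 9 ≤ ell D ^ 9 := pow_le_pow_left₀ (by norm_num) hL 9
  have h9' : (19683 : ℝ) ≤ ell D ^ 9 := by norm_num at h9; linarith
  -- the `t`-range
  have h114 : (3 : ℝ) ≤ ell D ^ 114 := le_trans hL (le_self_pow₀ hL1 (by norm_num))
  have h405a : (1 : ℝ) ≤ ell D ^ 405 := one_le_pow₀ hL1
  have h405 : ell D ^ 405 + 2 ≤ ell D ^ 519 := by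
    have h1 : ell D ^ 519 = ell D ^ 405 * ell D ^ 114 := by rw [← pow_add]
    rw [h1]; nlinarith
  have h519_3 : (3 : ℝ) ≤ ell D ^ 519 := le_trans hL (le_self_pow₀ hL1 (by norm_num))
  obtain ⟨hta, htb⟩ := abs_lt.mp ht
  have hπ3 : (3 : ℝ) < π := Real.pi_gt_three
  have hπ315 : π < 3.15 := Real.pi_lt_d2
  have h519 : 0 < ell D ^ 519 := by positivity
  have h2π_lo : 6 * ell D ^ 519 ≤ 2 * π * ell D ^ 519 := by nlinarith
  have h2π_hi : 2 * π * ell D ^ 519 ≤ 6.3 * ell D ^ 519 := by nlinarith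
  have ht5 : 5 * ell D ^ 519 ≤ t := by linarith
  have ht8 : t ≤ 8 * ell D ^ 519 := by linarith
  have ht0 : 0 < t := by linarith
  have ht4 : 4 ≤ t := by linarith
  have hσ4 : |σ - 1 / 2| ≤ 1 / 4 := hσ.trans (by rw [hα]; exact Section6Statements.two_alpha_le hL)
  -- the logarithm of `pt/2π`
  obtain ⟨hPp, hlogp, -⟩ := Section6Statements.log_window x hL
  have hP1 : 1 ≤ bigP D := by rw [bigP]; exact Real.one_le_exp (by positivity)
  have hp1 : (1 : ℝ) < x.p := lt_of_le_of_lt hP1 hPp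
  have hp0 : (0 : ℝ) < x.p := by linarith
  have h2π : (0 : ℝ) < 2 * π := by positivity
  have hq1 : 1 ≤ (x.p : ℝ) * t / (2 * π) := by
    rw [le_div_iff₀ h2π, one_mul]
    have : (8 : ℝ) ≤ t := by linarith
    nlinarith
  have hlogq0 : 0 ≤ Real.log ((x.p : ℝ) * t / (2 * π)) := Real.log_nonneg hq1
  have hℓlog : Real.log (ell D) ≤ ell D := (Real.log_le_sub_one_of_pos hL0).trans (by linarith)
  have hlogt : Real.log t ≤ 3 + 519 * ell D := by
    calc Real.log t ≤ Real.log (8 * ell D ^ 519) := Real.log_le_log ht0 ht8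
      _ = Real.log 8 + 519 * Real.log (ell D) := by
          rw [Real.log_mul (by norm_num) h519.ne', Real.log_pow]; push_cast; ring
      _ ≤ 3 + 519 * ell D := by
          have h8 : Real.log 8 ≤ 3 := by
            rw [show (8 : ℝ) = 2 ^ 3 by norm_num, Real.log_pow]; push_cast
            linarith [Real.log_two_lt_d9]
          linarith
  have hlogq : Real.log ((x.p : ℝ) * t / (2 * π)) ≤ 2 * ell D ^ 9 := by
    calc Real.log ((x.p : ℝ) * t / (2 * π))
        = Real.log (x.p : ℝ) + Real.log t - Real.log (2 * π) := by
          rw [Real.log_div (by positivity) h2π.ne', Real.log_mul hp0.ne' ht0.ne']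
      _ ≤ (ell D ^ 9 + ell D + 1) + (3 + 519 * ell D) - 0 := by
          gcongr
          exact Real.log_nonneg (by linarith)
      _ ≤ 2 * ell D ^ 9 := by
          have h8 : (6561 : ℝ) ≤ ell D ^ 8 := le_trans (by norm_num) (pow_le_pow_left₀ (by norm_num) hL 8)
          have h98 : ell D ^ 9 = ell D * ell D ^ 8 := by ring
          nlinarith [mul_le_mul_of_nonneg_left h8 hL0.le]
  have h14 : 14 / t ≤ 1 := by rw [div_le_iff₀ ht0]; linarith
  have h14' : 0 ≤ 14 / t := by positivity
  have hexp : |σ - 1 / 2| * (|Real.log ((x.p : ℝ) * t / (2 * π))| + 14 / t) ≤ 16 := by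
    rw [abs_of_nonneg hlogq0]
    calc |σ - 1 / 2| * (Real.log ((x.p : ℝ) * t / (2 * π)) + 14 / t)
        ≤ (2 * (π / ell D ^ 9)) * (2 * ell D ^ 9 + 1) := by
          have hα0 : 0 ≤ 2 * alpha D := by rw [hα]; positivity
          rw [← hα]
          exact mul_le_mul hσ (by linarith) (add_nonneg hlogq0 h14') hα0
      _ = 4 * π + 2 * π / ell D ^ 9 := by field_simp; ring
      _ ≤ 16 := by
          have : 2 * π / ell D ^ 9 ≤ 1 := by rw [div_le_iff₀ (by positivity)]; nlinarith
          linarith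
  have hlow := exp_neg_le_norm_Zfac_of_abs_sub_half_le x.prim hσ4 ht4
  have hpos : 0 < Real.exp (-(|σ - 1 / 2| * (|Real.log ((x.p : ℝ) * t / (2 * π))| + 14 / t))) :=
    Real.exp_pos _
  rw [norm_inv]
  calc ‖Zfac x.ψ ((σ : ℂ) + t * I)‖⁻¹
      ≤ (Real.exp (-(|σ - 1 / 2| * (|Real.log ((x.p : ℝ) * t / (2 * π))| + 14 / t))))⁻¹ :=
        inv_anti₀ hpos hlow
    _ = Real.exp (|σ - 1 / 2| * (|Real.log ((x.p : ℝ) * t / (2 * π))| + 14 / t)) := by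
        rw [Real.exp_neg, inv_inv]
    _ ≤ Real.exp 16 := Real.exp_le_exp.mpr hexp

/-! ## The large sieve for weighted short Dirichlet polynomials -/

/-- The absolute constant of the tree's `Skeleton.lemma33b_sum_le` (Lemma 3.3, second assertion).
[cite: Zhang2022LandauSiegel, Lemma 3.3 p.14] -/
theorem c33_nonneg : (0 : ℝ) ≤ 2 + 2 * (3 + (Real.log 2 ^ 68)⁻¹) ^ 2 := by positivity

/-- **Large sieve, repackaged** (from the tree's kernel-proved `Skeleton.lemma33b_sum_le`): for any
finite set `T` of members of `Ψ`, any `s`, any `N ≤ ⌊P²⌋ + 1` and weights `|w(n)| ≤ 1`,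
`Σ_{ψ∈T} |Σ_{1≤n<N} ψ(n)n^{−s}w(n)|² ≤ C₃₃·P²·Σ_{1≤n≤P²} n^{−2σ}`.
[cite: Zhang2022LandauSiegel, Lemma 3.3 p.14; §13 p.75] -/
theorem meanSq_Ico_le {D : ℕ} (T : Finset (Chr D)) (s : ℂ) {N : ℕ} (hN : N ≤ ⌊bigP D ^ 2⌋₊ + 1)
    (w : ℕ → ℂ) (hw : ∀ n, ‖w n‖ ≤ 1) :
    ∑ x ∈ T, ‖∑ n ∈ Finset.Ico 1 N, x.ψ (n : ZMod x.p) * (n : ℂ) ^ (-s) * w n‖ ^ 2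
      ≤ (2 + 2 * (3 + (Real.log 2 ^ 68)⁻¹) ^ 2) * bigP D ^ 2 *
          ∑ n ∈ Finset.Icc 1 ⌊bigP D ^ 2⌋₊, (n : ℝ) ^ (-2 * s.re) := by
  classical
  set c : ℕ → ℂ := fun n => if n < N then w n else 0 with hc
  have hfilter : (Finset.Icc 1 ⌊bigP D ^ 2⌋₊).filter (fun n => n < N) = Finset.Ico 1 N := by
    ext n
    simp only [Finset.mem_filter, Finset.mem_Icc, Finset.mem_Ico]
    constructor
    · rintro ⟨⟨h1, -⟩, h3⟩; exact ⟨h1, h3⟩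
    · rintro ⟨h1, h3⟩; exact ⟨⟨h1, by omega⟩, h3⟩
  have hinner : ∀ x : Chr D,
      ∑ n ∈ Finset.Ico 1 N, x.ψ (n : ZMod x.p) * (n : ℂ) ^ (-s) * w n =
        ∑ n ∈ Finset.Icc 1 ⌊bigP D ^ 2⌋₊, c n * x.ψ (n : ZMod x.p) * (n : ℂ) ^ (-s) := by
    intro x
    have : ∀ n, c n * x.ψ (n : ZMod x.p) * (n : ℂ) ^ (-s) =
        if n < N then x.ψ (n : ZMod x.p) * (n : ℂ) ^ (-s) * w n else 0 := by
      intro n; simp only [hc]; split_ifs <;> ring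
    simp_rw [this]
    rw [Finset.sum_ite, Finset.sum_const_zero, add_zero, hfilter]
  simp_rw [hinner]
  refine le_trans (lemma33b_sum_le T s c) (mul_le_mul_of_nonneg_left ?_ ?_)
  · refine Finset.sum_le_sum fun n _ => ?_
    have hcn : ‖c n‖ ≤ 1 := by
      simp only [hc]; split_ifs
      · exact hw n
      · simp
    have h0 : 0 ≤ (n : ℝ) ^ (-2 * s.re) := Real.rpow_nonneg (Nat.cast_nonneg n) _
    calc ‖c n‖ ^ 2 * (n : ℝ) ^ (-2 * s.re) ≤ 1 * (n : ℝ) ^ (-2 * s.re) := by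
          refine mul_le_mul_of_nonneg_right ?_ h0
          calc ‖c n‖ ^ 2 ≤ 1 ^ 2 := pow_le_pow_left₀ (norm_nonneg _) hcn 2
            _ = 1 := one_pow 2
      _ = (n : ℝ) ^ (-2 * s.re) := one_mul _
  · exact mul_nonneg c33_nonneg (by positivity)

/-- **`Σ_{1≤n≤P²} n^{e} ≤ e^{8π}(1 + 2𝓛⁹)` for `|e + 1| ≤ 4α`** (`n^{e+1} ≤ (P²)^{4α} = e^{8π}`,
`Σ_{n≤P²} 1/n ≤ 1 + log P² = 1 + 2𝓛⁹`); used with `e = −2σ`, `|σ − 1/2| ≤ 2α`.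
[cite: Zhang2022LandauSiegel, §13 p.75; §8 p.44] -/
theorem sum_rpow_Icc_le {D : ℕ} (hL : 1 ≤ ell D) {e : ℝ} (he : |e + 1| ≤ 4 * alpha D) :
    ∑ n ∈ Finset.Icc 1 ⌊bigP D ^ 2⌋₊, (n : ℝ) ^ e ≤ Real.exp (8 * π) * (1 + 2 * ell D ^ 9) := by
  have hL0 : 0 < ell D := by linarith
  have hα : alpha D = π / ell D ^ 9 := by rw [alpha, bigP, Real.log_exp]
  have hP2 : bigP D ^ 2 = Real.exp (2 * ell D ^ 9) := by rw [bigP, ← Real.exp_nat_mul]; ring_nf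
  have hP2_1 : 1 ≤ bigP D ^ 2 := by rw [hP2]; exact Real.one_le_exp (by positivity)
  have hP2pos : 0 < bigP D ^ 2 := by positivity
  -- each term: `n^e ≤ e^{8π} · n⁻¹`
  have hterm : ∀ n ∈ Finset.Icc 1 ⌊bigP D ^ 2⌋₊, (n : ℝ) ^ e ≤ Real.exp (8 * π) * (n : ℝ)⁻¹ := by
    intro n hn
    rw [Finset.mem_Icc] at hn
    have hn1 : (1 : ℝ) ≤ n := by exact_mod_cast hn.1
    have hn0 : (0 : ℝ) < n := by linarith
    have hnP : (n : ℝ) ≤ bigP D ^ 2 := le_trans (by exact_mod_cast hn.2) (Nat.floor_le hP2pos.le)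
    have h1 : (n : ℝ) ^ e = (n : ℝ) ^ (e + 1) * (n : ℝ)⁻¹ := by
      rw [Real.rpow_add hn0, Real.rpow_one, mul_assoc, mul_inv_cancel₀ hn0.ne', mul_one]
    rw [h1]
    refine mul_le_mul_of_nonneg_right ?_ (inv_nonneg.mpr hn0.le)
    calc (n : ℝ) ^ (e + 1) ≤ (n : ℝ) ^ |e + 1| :=
          Real.rpow_le_rpow_of_exponent_le hn1 (le_abs_self _)
      _ ≤ (bigP D ^ 2) ^ |e + 1| := Real.rpow_le_rpow hn0.le hnP (abs_nonneg _)
      _ ≤ (bigP D ^ 2) ^ (4 * alpha D) := Real.rpow_le_rpow_of_exponent_le hP2_1 he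
      _ = Real.exp (8 * π) := by
          rw [hP2, ← Real.exp_mul, hα]
          congr 1
          field_simp
          ring
  -- the harmonic sum
  have hharm : ∑ n ∈ Finset.Icc 1 ⌊bigP D ^ 2⌋₊, (n : ℝ)⁻¹ ≤ 1 + 2 * ell D ^ 9 := by
    have h := harmonic_le_one_add_log ⌊bigP D ^ 2⌋₊
    rw [harmonic_eq_sum_Icc] at h
    push_cast at h
    refine h.trans ?_
    have hlog : Real.log (⌊bigP D ^ 2⌋₊ : ℝ) ≤ 2 * ell D ^ 9 := by
      by_cases h0 : ⌊bigP D ^ 2⌋₊ = 0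
      · rw [h0]; simp; positivity
      · have hpos : (0 : ℝ) < ⌊bigP D ^ 2⌋₊ := by exact_mod_cast Nat.pos_of_ne_zero h0
        calc Real.log (⌊bigP D ^ 2⌋₊ : ℝ) ≤ Real.log (bigP D ^ 2) :=
              Real.log_le_log hpos (Nat.floor_le hP2pos.le)
          _ = 2 * ell D ^ 9 := by rw [hP2, Real.log_exp]
    linarith
  calc ∑ n ∈ Finset.Icc 1 ⌊bigP D ^ 2⌋₊, (n : ℝ) ^ e
      ≤ ∑ n ∈ Finset.Icc 1 ⌊bigP D ^ 2⌋₊, Real.exp (8 * π) * (n : ℝ)⁻¹ := Finset.sum_le_sum hterm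
    _ = Real.exp (8 * π) * ∑ n ∈ Finset.Icc 1 ⌊bigP D ^ 2⌋₊, (n : ℝ)⁻¹ := by
        rw [Finset.mul_sum]
    _ ≤ Real.exp (8 * π) * (1 + 2 * ell D ^ 9) :=
        mul_le_mul_of_nonneg_left hharm (Real.exp_nonneg _)

/-- **Large sieve, unweighted short sums**: `Σ_{ψ∈T} |Σ_{1≤n<N} ψ(n)n^{−s}|² ≤ C₃₃·P²·Σ_{n≤P²} n^{−2σ}`
(`N ≤ ⌊P²⌋ + 1`). [cite: Zhang2022LandauSiegel, Lemma 3.3 p.14; §13 p.75] -/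
theorem meanSq_Ico_le_one {D : ℕ} (T : Finset (Chr D)) (s : ℂ) {N : ℕ} (hN : N ≤ ⌊bigP D ^ 2⌋₊ + 1) :
    ∑ x ∈ T, ‖∑ n ∈ Finset.Ico 1 N, x.ψ (n : ZMod x.p) * (n : ℂ) ^ (-s)‖ ^ 2
      ≤ (2 + 2 * (3 + (Real.log 2 ^ 68)⁻¹) ^ 2) * bigP D ^ 2 *
          ∑ n ∈ Finset.Icc 1 ⌊bigP D ^ 2⌋₊, (n : ℝ) ^ (-2 * s.re) := by
  have h := meanSq_Ico_le T s hN (fun _ => (1 : ℂ)) (fun _ => by simp)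
  simpa only [mul_one] using h

/-- **The number of characters in a finite subfamily of `Ψ` is `≤ C₃₃P²·Σ_{n≤P²}n^{−2σ}`** (the large
sieve applied to the constant polynomial `1`; any `s`; needs `P² ≥ 1`).
[cite: Zhang2022LandauSiegel, Lemma 3.3 p.14] -/
theorem card_le_meanSq {D : ℕ} (T : Finset (Chr D)) (s : ℂ) (hP : 1 ≤ ⌊bigP D ^ 2⌋₊) :
    (T.card : ℝ) ≤ (2 + 2 * (3 + (Real.log 2 ^ 68)⁻¹) ^ 2) * bigP D ^ 2 *
          ∑ n ∈ Finset.Icc 1 ⌊bigP D ^ 2⌋₊, (n : ℝ) ^ (-2 * s.re) := by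
  have h := meanSq_Ico_le_one T s (N := 2) (by omega)
  have h1 : ∀ x ∈ T,
      ‖∑ n ∈ Finset.Ico (1 : ℕ) 2, x.ψ ((n : ℕ) : ZMod x.p) * ((n : ℕ) : ℂ) ^ (-s)‖ ^ 2 = 1 := by
    intro x _
    have : Finset.Ico (1 : ℕ) 2 = {1} := by decide
    rw [this, Finset.sum_singleton]
    simp
  rw [Finset.sum_congr rfl h1] at h
  simpa using h

/-! ## Cauchy–Schwarz for interval integrals of continuous functions -/

/-- **`(∫_a^b f)² ≤ (b − a)·∫_a^b f²`** for a continuous real `f` and `a ≤ b` (expand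
`0 ≤ ∫_a^b (f − m)²` at the mean `m`). [folklore] -/
private theorem sq_integral_le {f : ℝ → ℝ} (hf : Continuous f) {a b : ℝ} (hab : a ≤ b) :
    (∫ v in a..b, f v) ^ 2 ≤ (b - a) * ∫ v in a..b, f v ^ 2 := by
  rcases eq_or_lt_of_le hab with h | h
  · subst h; simp
  have hba : 0 < b - a := by linarith
  set J : ℝ := ∫ v in a..b, f v with hJ
  set m : ℝ := J / (b - a) with hm
  have hi1 : IntervalIntegrable f volume a b := hf.intervalIntegrable _ _
  have hi2 : IntervalIntegrable (fun v => f v ^ 2) volume a b := (hf.pow 2).intervalIntegrable _ _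
  have hi3 : IntervalIntegrable (fun v => (f v - m) ^ 2) volume a b :=
    ((hf.sub continuous_const).pow 2).intervalIntegrable _ _
  have hnn : 0 ≤ ∫ v in a..b, (f v - m) ^ 2 :=
    intervalIntegral.integral_nonneg hab fun v _ => sq_nonneg _
  have hexpand : ∫ v in a..b, (f v - m) ^ 2 =
      (∫ v in a..b, f v ^ 2) - 2 * m * J + m ^ 2 * (b - a) := by
    have : (fun v => (f v - m) ^ 2) = fun v => f v ^ 2 - (2 * m) * f v + m ^ 2 := by
      funext v; ring
    rw [this, intervalIntegral.integral_add (hi2.sub (hi1.const_mul _)) (by simp),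
      intervalIntegral.integral_sub hi2 (hi1.const_mul _), intervalIntegral.integral_const_mul,
      intervalIntegral.integral_const]
    simp only [smul_eq_mul]
    ring
  have hmJ : m * (b - a) = J := by rw [hm]; field_simp
  have key : J ^ 2 = (b - a) * (2 * m * J - m ^ 2 * (b - a)) := by
    have : J = m * (b - a) := hmJ.symm
    rw [this]; ring
  rw [key]
  exact mul_le_mul_of_nonneg_left (by linarith [hexpand ▸ hnn]) hba.le

/-! ## The mean square of Lemma 6.1's error `E₁(s,ψ)` over a subfamily of `Ψ` -/

/-- The short Dirichlet polynomial inside `E₁`, `v ↦ |Σ_{n<N} ψ(n)n^{−(s+iv)}|`, is continuous in `v`.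
[cite: Zhang2022LandauSiegel, §6 Lemma 6.1] -/
theorem continuous_norm_dirPoly_shift {D : ℕ} (x : Chr D) (s : ℂ) (N : ℕ) :
    Continuous fun v : ℝ =>
      ‖∑ n ∈ Finset.Ico 1 N, x.ψ (n : ZMod x.p) * (n : ℂ) ^ (-(s + v * I))‖ := by
  refine Continuous.norm (continuous_finsetSum _ fun n hn => ?_)
  rw [Finset.mem_Ico] at hn
  have hn0 : (n : ℂ) ≠ 0 := by exact_mod_cast (show n ≠ 0 by omega)
  refine continuous_const.mul (Continuous.const_cpow ?_ (Or.inl hn0))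
  exact (continuous_const.add (Complex.continuous_ofReal.mul continuous_const)).neg

/-- **`Σ_{ψ∈T} E₁(s,ψ)² ≤ 4C₃₃e^{8π}·P²(1 + 2𝓛⁹)`** for `|σ − 1/2| ≤ 2α`, `𝓛 ≥ 3` (Cauchy–Schwarz in
`v`, `ω₁(iv) ≤ 1`, interchange of the finite `ψ`-sum with `∫dv`, and the large sieve at each
`s + iv`; the prefactor `𝓛⁻¹³⁶·(2𝓛²⁰)²` is `≤ 4`). [cite: Zhang2022LandauSiegel, §6 Lemma 6.1; §13 p.75] -/
theorem sum_E1main_sq_le {D : ℕ} (T : Finset (Chr D)) (hL : 3 ≤ ell D) {s : ℂ}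
    (hs : |s.re - 1 / 2| ≤ 2 * alpha D) (hN : ⌈bigT D ^ 3⌉₊ ≤ ⌊bigP D ^ 2⌋₊ + 1) :
    ∑ x ∈ T, E1main x s ^ 2 ≤
      4 * ((2 + 2 * (3 + (Real.log 2 ^ 68)⁻¹) ^ 2) * bigP D ^ 2 *
        (Real.exp (8 * π) * (1 + 2 * ell D ^ 9))) := by
  have hL1 : 1 ≤ ell D := by linarith
  have hL0 : 0 < ell D := by linarith
  set Lw : ℝ := ell D ^ 20 with hLw
  have hLw0 : 0 < Lw := by positivity
  set M : ℝ := (2 + 2 * (3 + (Real.log 2 ^ 68)⁻¹) ^ 2) * bigP D ^ 2 *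
    (Real.exp (8 * π) * (1 + 2 * ell D ^ 9)) with hM
  have hM0 : 0 ≤ M := by rw [hM]; exact mul_nonneg (mul_nonneg c33_nonneg (by positivity)) (by positivity)
  -- the polynomial and the weight
  set F : Chr D → ℝ → ℝ := fun x v =>
    ‖∑ n ∈ Finset.Ico 1 ⌈bigT D ^ 3⌉₊, x.ψ (n : ZMod x.p) * (n : ℂ) ^ (-(s + v * I))‖ with hF
  set wt : ℝ → ℝ := fun v => Real.exp (-(v ^ 2) / (4 * ell D ^ 30)) with hwt
  have hFc : ∀ x, Continuous (F x) := fun x => continuous_norm_dirPoly_shift x s _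
  have hwtc : Continuous wt := by
    rw [hwt]; exact Real.continuous_exp.comp (by fun_prop)
  have hwt01 : ∀ v, 0 ≤ wt v ∧ wt v ≤ 1 := by
    intro v
    refine ⟨Real.exp_nonneg _, ?_⟩
    rw [hwt]; dsimp only
    rw [Real.exp_le_one_iff, neg_div]
    have : 0 ≤ v ^ 2 / (4 * ell D ^ 30) := by positivity
    linarith
  have hF0 : ∀ x v, 0 ≤ F x v := fun x v => norm_nonneg _
  -- (1) Cauchy–Schwarz for each `ψ`
  have hE : ∀ x, E1main x s ^ 2 ≤ (ell D ^ 68)⁻¹ ^ 2 * ((2 * Lw) * ∫ v in (-Lw)..Lw, F x v ^ 2) := by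
    intro x
    have hdef : E1main x s = (ell D ^ 68)⁻¹ * ∫ v in (-Lw)..Lw, F x v * wt v := rfl
    rw [hdef, mul_pow]
    refine mul_le_mul_of_nonneg_left ?_ (sq_nonneg _)
    have hcs := sq_integral_le ((hFc x).mul hwtc) (show -Lw ≤ Lw by linarith)
    rw [show Lw - -Lw = 2 * Lw by ring] at hcs
    refine hcs.trans (mul_le_mul_of_nonneg_left ?_ (by linarith))
    refine intervalIntegral.integral_mono_on (by linarith)
      ((((hFc x).mul hwtc).pow 2).intervalIntegrable _ _)
      (((hFc x).pow 2).intervalIntegrable _ _) fun v _ => ?_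
    obtain ⟨h0, h1⟩ := hwt01 v
    have := hF0 x v
    calc (F x v * wt v) ^ 2 = F x v ^ 2 * wt v ^ 2 := by ring
      _ ≤ F x v ^ 2 * 1 := by
          refine mul_le_mul_of_nonneg_left ?_ (sq_nonneg _)
          calc wt v ^ 2 ≤ 1 ^ 2 := pow_le_pow_left₀ h0 h1 2
            _ = 1 := one_pow 2
      _ = F x v ^ 2 := mul_one _
  -- (2) the large sieve at each `s + iv`
  have hpt : ∀ v : ℝ, ∑ x ∈ T, F x v ^ 2 ≤ M := by
    intro v
    have h1 := meanSq_Ico_le_one T (s + v * I) hN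
    have hre : (s + v * I).re = s.re := by simp
    rw [hre] at h1
    refine h1.trans ?_
    rw [hM]
    refine mul_le_mul_of_nonneg_left ?_ (mul_nonneg c33_nonneg (by positivity))
    refine sum_rpow_Icc_le hL1 ?_
    have : -2 * s.re + 1 = -2 * (s.re - 1 / 2) := by ring
    rw [this, abs_mul, abs_neg, abs_two]
    linarith
  -- (3) interchange and integrate the constant bound
  have hint : ∑ x ∈ T, ∫ v in (-Lw)..Lw, F x v ^ 2 ≤ 2 * Lw * M := by
    rw [← intervalIntegral.integral_finsetSum (f := fun x v => F x v ^ 2)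
      (fun x _ => ((hFc x).pow 2).intervalIntegrable _ _)]
    have hcont : Continuous fun v => ∑ x ∈ T, F x v ^ 2 :=
      continuous_finsetSum _ fun x _ => (hFc x).pow 2
    calc ∫ v in (-Lw)..Lw, ∑ x ∈ T, F x v ^ 2 ≤ ∫ v in (-Lw)..Lw, M :=
          intervalIntegral.integral_mono_on (by linarith) (hcont.intervalIntegrable _ _)
            intervalIntegrable_const fun v _ => hpt v
      _ = 2 * Lw * M := by rw [intervalIntegral.integral_const, smul_eq_mul]; ring
  -- (4) assemble
  calc ∑ x ∈ T, E1main x s ^ 2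
      ≤ ∑ x ∈ T, (ell D ^ 68)⁻¹ ^ 2 * ((2 * Lw) * ∫ v in (-Lw)..Lw, F x v ^ 2) :=
        Finset.sum_le_sum fun x _ => hE x
    _ = (ell D ^ 68)⁻¹ ^ 2 * (2 * Lw) * ∑ x ∈ T, ∫ v in (-Lw)..Lw, F x v ^ 2 := by
        rw [Finset.mul_sum]; refine Finset.sum_congr rfl fun x _ => ?_; ring
    _ ≤ (ell D ^ 68)⁻¹ ^ 2 * (2 * Lw) * (2 * Lw * M) :=
        mul_le_mul_of_nonneg_left hint (by positivity)
    _ = 4 * ((ell D ^ 40) / (ell D ^ 136)) * M := by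
        rw [hLw]; field_simp; ring
    _ ≤ 4 * 1 * M := by
        refine mul_le_mul_of_nonneg_right (mul_le_mul_of_nonneg_left ?_ (by norm_num)) hM0
        rw [div_le_one (by positivity)]
        exact pow_le_pow_right₀ hL1 (by norm_num)
    _ = 4 * M := by ring

end Literature.NumberTheory.LFunctions.Zhang2022.Typed.Section13
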